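import Mathlib

/-!
# BalabanUVNodes ∕ N22 knit, HADAMARD'S THREE LINES ON A DISC — `‖G(p + ib) − c‖ ≤ ε^{1−t}K^{t}` on the vertical chord of a disc on which
# `G` is analytic with `‖G − c‖ ≤ K` and FLAT (`≤ ε`) on the real diameter, `t ∝ |b|` (Mathlib's `Complex.HadamardThreeLines` transported by
# a Cayley-type map); the complex-interpolation engine of ROAD 3 to node N22 (`BalabanUVNodesN22KnitTwoConstants`: the derivative bound
# `ε^{1−s}B^{s}∕(s²r)`; `…AnalyticFading`: fading memory from the tower rate `θ` and analyticity with bounds growing at ANY geometric rate)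
# (Track A, DAG node N22 = NE9; cluster K4 «SpineRates»; seat `pub-ymgap-dag-n22-a`)

HONEST FRAMING.  Pure one-variable complex analysis ([folklore]: the Hadamard–Doetsch three-lines theorem, Nevanlinna's two-constants principle
in an elementary disc form); nothing of Bałaban's construction is used or asserted; count-neutral; NOT a node discharge.  0 `sorry`, 0 `def`,
standard axioms.  `--supports` item `SpineGivenEndpoint` (route «BalabanUVNodes», cluster K4).

WHY.  ROAD 2 to node N22 (`BalabanUVNodesN22Knit{,Discrete,Analytic,Linear}`) interpolates between the OSCILLATION bound (O) `ε_a = C₀θ^{a}`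
(node N18's tower rate; `a` = age of the coupling) and a REGULARITY bound by the REAL-variable Landau–Kolmogorov inequality `|f′| ≲ ε∕h + Mh`,
whose square-root loss ties `θ` to the growth of the regularity constants (`θμ ≤ τ²`, `θν ≤ τ²`).  For ANALYTIC sections the interpolation
can be done in the complex plane: `|F − c| ≤ ε` on a real segment and `|F − c| ≤ K` on a disc give `|F − c| ≤ ε^{1−t}K^{t}` at height
`∝ t` above the segment — the loss `K^{t}` has `t` AS SMALL AS DESIRED, so on ROAD 3 the growth of `K` with the age is irrelevant.
* §1 the Cayley-type map `z ↦ p + ρ·(e^{iπz∕2} − 1)∕(e^{iπz∕2} + 1)` of the closed vertical strip `|Re z| ≤ 1` into the closed disc `D̄(p, ρ)`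
  (`re_exp_nonneg`, `norm_moebius_le_one`, `norm_cayley_sub_le`), the line `Re z = 0` onto the real diameter (`cayley_real_of_re_zero`), and the
  unit-circle parametrisation of the vertical chord (`sigma_bound_of_unit`: `σ = (2∕π)arg w`, `|σ| ≤ |Im w|` by Jordan's inequality,
  `e^{iπσ∕2} = w`; `unit_of_height`: `w = (1 + iβ)∕(1 − iβ)` has Möbius value `iβ` and `|Im w| ≤ 2|β|`).
* §2 `threeLines_strip` — Mathlib's three-lines theorem on `[0, 1]` and, through `z ↦ −z`, on `[−1, 0]`: `‖H σ‖ ≤ ε^{1−|σ|}K^{|σ|}`;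
  **`threeLines_vertical`** — transported to the disc: `‖G(p + ib) − c‖ ≤ ε^{1−t}K^{t}` for `t ≥ 2|b|∕ρ`; **`box_bound`** — `G` flat on
  `[−L, L]`, `K`-bounded on `D̄(0, L)` ⟹ `‖G − c‖ ≤ ε^{1−s}K^{s}` on the box `|Re ζ| ≤ L∕2`, `|Im ζ| ≤ Ls∕4`.

References (TYPES only): Mathlib `Mathlib.Analysis.Complex.Hadamard`; [Balaban1987RG1] = T. Bałaban, Commun. Math. Phys. **109** (1987)
249–301, p. 263 («(or analytic)») — the printed clause whose TYPE ROAD 3 consumes.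
-/

noncomputable section

namespace Summit.QuantumFields.YangMills.BalabanUVNodes.N22KnitThreeLines

open Set Metric Complex Real Filter
open scoped Real Topology

/-! ## §1 The Cayley-type map from the vertical strip to the disc -/

/-- On the closed vertical strip `|Re z| ≤ 1` the point `e^{iπz∕2}` lies in the closed right half-plane. [folklore] -/
theorem re_exp_nonneg {z : ℂ} (hz : |z.re| ≤ 1) : 0 ≤ (exp (I * (π / 2) * z)).re := by
  rw [Complex.exp_re]
  have him : (I * (π / 2) * z).im = π / 2 * z.re := by simp [mul_assoc]
  rw [him]
  refine mul_nonneg (Real.exp_pos _).le (Real.cos_nonneg_of_mem_Icc ⟨?_, ?_⟩)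
  · have := (abs_le.mp hz).1; nlinarith [Real.pi_pos]
  · have := (abs_le.mp hz).2; nlinarith [Real.pi_pos]

/-- The Möbius map `w ↦ (w − 1)∕(w + 1)` sends the closed right half-plane into the closed unit disc (and `w + 1 ≠ 0` there). [folklore] -/
theorem norm_moebius_le_one {w : ℂ} (hw : 0 ≤ w.re) : w + 1 ≠ 0 ∧ ‖(w - 1) / (w + 1)‖ ≤ 1 := by
  have hne : w + 1 ≠ 0 := by
    intro h
    have := congrArg Complex.re h
    simp at this
    linarith
  refine ⟨hne, ?_⟩
  rw [norm_div, div_le_one (norm_pos_iff.mpr hne)]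
  rw [Complex.norm_def, Complex.norm_def]
  refine Real.sqrt_le_sqrt ?_
  simp only [Complex.normSq_apply, Complex.sub_re, Complex.one_re, Complex.sub_im, Complex.one_im, Complex.add_re, Complex.add_im]
  nlinarith

/-- The Cayley-type map lands in the closed disc: `‖ρ·(e^{iπz∕2} − 1)∕(e^{iπz∕2} + 1)‖ ≤ ρ` for `|Re z| ≤ 1`, `ρ ≥ 0`. [folklore] -/
theorem norm_cayley_sub_le {z : ℂ} (hz : |z.re| ≤ 1) {ρ : ℝ} (hρ : 0 ≤ ρ) :
    ‖(ρ : ℂ) * ((exp (I * (π / 2) * z) - 1) / (exp (I * (π / 2) * z) + 1))‖ ≤ ρ := by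
  rw [norm_mul, Complex.norm_real, Real.norm_of_nonneg hρ]
  exact mul_le_of_le_one_right hρ (norm_moebius_le_one (re_exp_nonneg hz)).2

/-- On the line `Re z = 0` the Cayley-type map is REAL and within `ρ` of the centre. [folklore] -/
theorem cayley_real_of_re_zero {z : ℂ} (hz : z.re = 0) (p : ℝ) {ρ : ℝ} (hρ : 0 ≤ ρ) :
    ∃ η : ℝ, |η - p| ≤ ρ ∧ (p : ℂ) + ρ * ((exp (I * (π / 2) * z) - 1) / (exp (I * (π / 2) * z) + 1)) = η := by
  -- `I (π/2) z` is the real number `−(π/2)·Im z`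
  have hz' : z = (z.im : ℂ) * I := by
    apply Complex.ext <;> simp [hz]
  set u : ℝ := Real.exp (-(π / 2 * z.im)) with hu
  have hexp : exp (I * (π / 2) * z) = (u : ℂ) := by
    rw [hz', hu, Complex.ofReal_exp]
    congr 1
    push_cast
    ring_nf
    rw [Complex.I_sq]
    ring
  have hu0 : 0 < u := Real.exp_pos _
  refine ⟨p + ρ * ((u - 1) / (u + 1)), ?_, ?_⟩
  · rw [add_sub_cancel_left, abs_mul, abs_of_nonneg hρ]
    refine mul_le_of_le_one_right hρ ?_
    rw [abs_div, abs_of_pos (by linarith : 0 < u + 1), div_le_one (by linarith)]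
    exact abs_le.mpr ⟨by linarith, by linarith⟩
  · rw [hexp]
    push_cast
    rfl

/-- A unit vector `w` in the open right half-plane: `σ = (2∕π)·arg w` has `|σ| < 1`, `|σ| ≤ |Im w|`, and `e^{iπσ∕2} = w`. [folklore] -/
theorem sigma_bound_of_unit {w : ℂ} (hw1 : ‖w‖ = 1) (hwre : 0 < w.re) :
    |2 / π * arg w| < 1 ∧ |2 / π * arg w| ≤ |w.im| ∧ exp (I * (π / 2) * ((2 / π * arg w : ℝ) : ℂ)) = w := by
  have hπ := Real.pi_pos
  have harg : |arg w| < π / 2 := Complex.abs_arg_lt_pi_div_two_iff.mpr (Or.inl hwre)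
  have h2π : 0 < 2 / π := by positivity
  refine ⟨?_, ?_, ?_⟩
  · rw [abs_mul, abs_of_pos h2π]
    calc 2 / π * |arg w| < 2 / π * (π / 2) := mul_lt_mul_of_pos_left harg h2π
      _ = 1 := by field_simp
  · -- Jordan's inequality `(2/π)·x ≤ sin x` on `[0, π/2]`, applied to `x = |arg w|`; `sin |arg w| = |sin (arg w)| = |Im w|`
    rw [abs_mul, abs_of_pos h2π]
    have hj := Real.mul_le_sin (abs_nonneg (arg w)) harg.le
    have hsin : Real.sin |arg w| = |Real.sin (arg w)| := by
      rcases le_or_gt 0 (arg w) with h | h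
      · rw [abs_of_nonneg h, abs_of_nonneg (Real.sin_nonneg_of_nonneg_of_le_pi h (by linarith [harg.le, abs_of_nonneg h]))]
      · rw [abs_of_neg h, Real.sin_neg, abs_of_nonpos]
        exact Real.sin_nonpos_of_nonpos_of_neg_pi_le h.le (by linarith [(abs_lt.mp harg).1])
    rw [hsin, Complex.sin_arg, hw1, div_one] at hj
    exact hj
  · have h := Complex.norm_mul_exp_arg_mul_I w
    rw [hw1, Complex.ofReal_one, one_mul] at h
    have hπ0 : (π : ℂ) ≠ 0 := Complex.ofReal_ne_zero.mpr Real.pi_ne_zero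
    have e : I * (π / 2) * ((2 / π * arg w : ℝ) : ℂ) = arg w * I := by
      push_cast
      field_simp
    rw [e]
    exact h

/-- The unit vector above height `β`: `w = (1 + iβ)∕(1 − iβ)` has `‖w‖ = 1`, `Re w > 0` for `|β| < 1`, `|Im w| ≤ 2|β|`, and Möbius value
`(w − 1)∕(w + 1) = iβ`. [folklore] -/
theorem unit_of_height {β : ℝ} (hβ : |β| < 1) :
    ‖(1 + I * β) / (1 - I * β)‖ = 1 ∧ 0 < ((1 + I * β) / (1 - I * β)).re ∧ |((1 + I * β) / (1 - I * β)).im| ≤ 2 * |β| ∧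
      ((1 + I * β) / (1 - I * β) - 1) / ((1 + I * β) / (1 - I * β) + 1) = I * β := by
  have hden : (1 : ℂ) - I * β ≠ 0 := by
    intro h; have := congrArg Complex.re h; simp at this
  have hnsq : Complex.normSq (1 - I * β) = 1 + β ^ 2 := by
    simp [Complex.normSq_apply]; ring
  have hb2 : 0 < 1 + β ^ 2 := by positivity
  have hre : ((1 + I * β) / (1 - I * β)).re = (1 - β ^ 2) / (1 + β ^ 2) := by
    rw [Complex.div_re, hnsq]; simp; field_simp; ring
  have him : ((1 + I * β) / (1 - I * β)).im = 2 * β / (1 + β ^ 2) := by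
    rw [Complex.div_im, hnsq]; simp; field_simp; ring
  refine ⟨?_, ?_, ?_, ?_⟩
  · rw [norm_div, Complex.norm_def, Complex.norm_def, hnsq]
    have : Complex.normSq (1 + I * β) = 1 + β ^ 2 := by simp [Complex.normSq_apply]; ring
    rw [this, div_self (Real.sqrt_pos.mpr hb2).ne']
  · rw [hre]
    have hβ2 : β ^ 2 < 1 := by
      have := abs_lt.mp hβ
      nlinarith
    exact div_pos (by linarith) hb2
  · rw [him, abs_div, abs_of_pos hb2, abs_mul, abs_two, div_le_iff₀ hb2]
    nlinarith [abs_nonneg β, sq_nonneg β]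
  · field_simp
    ring

/-! ## §2 Hadamard's three-lines theorem on a disc -/

/-- **THREE LINES ON THE VERTICAL STRIP `|Re z| ≤ 1`, BOTH SIGNS.**  `H` differentiable at every point of the closed strip `|Re z| ≤ 1`, `‖H‖ ≤ K`
there and `‖H‖ ≤ ε` on the line `Re z = 0` ⟹ `‖H σ‖ ≤ ε^{1−|σ|}·K^{|σ|}` for real `σ ∈ [−1, 1]` (Mathlib's
`Complex.HadamardThreeLines.norm_le_interp_of_mem_verticalClosedStrip₀₁'` on `[0, 1]`, and on `[−1, 0]` through `z ↦ H(−z)`). [folklore] -/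
theorem threeLines_strip {H : ℂ → ℂ} {K ε : ℝ} (hd : ∀ z : ℂ, |z.re| ≤ 1 → DifferentiableAt ℂ H z)
    (hK : ∀ z : ℂ, |z.re| ≤ 1 → ‖H z‖ ≤ K) (hε : ∀ z : ℂ, z.re = 0 → ‖H z‖ ≤ ε) {σ : ℝ} (hσ : |σ| ≤ 1) :
    ‖H σ‖ ≤ ε ^ (1 - |σ|) * K ^ |σ| := by
  -- the one-signed statement, for any `H'` with the same three properties
  have key : ∀ H' : ℂ → ℂ, (∀ z : ℂ, |z.re| ≤ 1 → DifferentiableAt ℂ H' z) → (∀ z : ℂ, |z.re| ≤ 1 → ‖H' z‖ ≤ K) →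
      (∀ z : ℂ, z.re = 0 → ‖H' z‖ ≤ ε) → ∀ t : ℝ, 0 ≤ t → t ≤ 1 → ‖H' t‖ ≤ ε ^ (1 - t) * K ^ t := by
    intro H' hd' hK' hε' t ht0 ht1
    have hclosed : ∀ z ∈ HadamardThreeLines.verticalClosedStrip 0 1, |z.re| ≤ 1 := by
      intro z hz
      have hz' : z.re ∈ Icc (0 : ℝ) 1 := hz
      exact abs_le.mpr ⟨by linarith [hz'.1], hz'.2⟩
    have hdiff : DiffContOnCl ℂ H' (HadamardThreeLines.verticalStrip 0 1) := by
      refine DifferentiableOn.diffContOnCl fun z hz => (hd' z (hclosed z ?_)).differentiableWithinAt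
      rw [HadamardThreeLines.verticalStrip, Complex.closure_preimage_re, closure_Ioo zero_ne_one] at hz
      exact hz
    have hB : BddAbove ((norm ∘ H') '' HadamardThreeLines.verticalClosedStrip 0 1) := by
      refine ⟨K, ?_⟩
      rintro _ ⟨z, hz, rfl⟩
      exact hK' z (hclosed z hz)
    have hz : ((t : ℝ) : ℂ) ∈ HadamardThreeLines.verticalClosedStrip 0 1 := by
      show ((t : ℝ) : ℂ).re ∈ Icc (0 : ℝ) 1
      rw [Complex.ofReal_re]; exact ⟨ht0, ht1⟩
    have h := HadamardThreeLines.norm_le_interp_of_mem_verticalClosedStrip₀₁' H' hz hdiff hB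
      (fun z hz => hε' z hz) (fun z hz => hK' z (by rw [show z.re = 1 from hz]; simp))
    simpa only [Complex.ofReal_re] using h
  rcases le_or_gt 0 σ with h0 | h0
  · rw [abs_of_nonneg h0] at hσ ⊢
    exact key H hd hK hε σ h0 hσ
  · -- reflect: `z ↦ H (−z)`
    have h1 : ‖H σ‖ = ‖(fun z => H (-z)) ((-σ : ℝ) : ℂ)‖ := by simp
    rw [h1, abs_of_neg h0]
    rw [abs_of_neg h0] at hσ
    refine key (fun z => H (-z)) (fun z hz => ?_) (fun z hz => hK _ (by simpa using hz)) (fun z hz => hε _ (by simpa using hz))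
      (-σ) (by linarith) hσ
    exact ((hd (-z) (by simpa using hz)).comp z differentiable_neg.differentiableAt :)

/-- **THREE LINES ON A DISC (two-constants estimate on the vertical chord).**  `G` complex-differentiable on the open disc `D(p, R₁)` (`p` real),
`ρ < R₁`, `‖G − c‖ ≤ K` on the closed disc `D̄(p, ρ)` and `‖G(η) − c‖ ≤ ε` for real `η ∈ [p − ρ, p + ρ]`; then on the vertical chord,
`‖G(p + ib) − c‖ ≤ ε^{1−t}K^{t}` for every `t ≥ 2|b|∕ρ` (`|b| < ρ∕2`, `0 < ε ≤ K`). Proof: the Cayley-type map `z ↦ p +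
ρ(e^{iπz∕2} − 1)∕(e^{iπz∕2} + 1)` carries `threeLines_strip` to the disc; the point `p + ib` is the image of the real point `σ = (2∕π)arg w`,
`w = (1 + iβ)∕(1 − iβ)`, `β = b∕ρ`, with `|σ| ≤ 2|β|`. [folklore] -/
theorem threeLines_vertical {G : ℂ → ℂ} {c : ℂ} {p ρ R₁ K ε : ℝ} (hρ : 0 < ρ) (hρR : ρ < R₁)
    (hG : DifferentiableOn ℂ G (ball (p : ℂ) R₁)) (hK : ∀ z ∈ closedBall (p : ℂ) ρ, ‖G z - c‖ ≤ K)
    (hflat : ∀ η : ℝ, |η - p| ≤ ρ → ‖G η - c‖ ≤ ε) (hε : 0 < ε) (hεK : ε ≤ K)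
    {b t : ℝ} (hb : 2 * |b| / ρ ≤ t) (hbρ : |b| < ρ / 2) :
    ‖G ((p : ℂ) + I * b) - c‖ ≤ ε ^ (1 - t) * K ^ t := by
  -- the transported function on the strip
  set H : ℂ → ℂ := fun z => G ((p : ℂ) + ρ * ((exp (I * (π / 2) * z) - 1) / (exp (I * (π / 2) * z) + 1))) - c with hH
  have hin : ∀ z : ℂ, |z.re| ≤ 1 →
      (p : ℂ) + ρ * ((exp (I * (π / 2) * z) - 1) / (exp (I * (π / 2) * z) + 1)) ∈ closedBall (p : ℂ) ρ := by
    intro z hz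
    rw [mem_closedBall, dist_eq_norm, add_sub_cancel_left]
    exact norm_cayley_sub_le hz hρ.le
  have hsub : closedBall (p : ℂ) ρ ⊆ ball (p : ℂ) R₁ := closedBall_subset_ball hρR
  have hd : ∀ z : ℂ, |z.re| ≤ 1 → DifferentiableAt ℂ H z := by
    intro z hz
    have hw := norm_moebius_le_one (re_exp_nonneg hz)
    have hcay : DifferentiableAt ℂ (fun z : ℂ => (p : ℂ) + ρ * ((exp (I * (π / 2) * z) - 1) / (exp (I * (π / 2) * z) + 1))) z := by
      have he : DifferentiableAt ℂ (fun z : ℂ => exp (I * (π / 2) * z)) z :=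
        (differentiableAt_id.const_mul _).cexp
      exact ((he.sub_const 1).div (he.add_const 1) hw.1).const_mul _ |>.const_add _
    have hGat : DifferentiableAt ℂ G ((p : ℂ) + ρ * ((exp (I * (π / 2) * z) - 1) / (exp (I * (π / 2) * z) + 1))) :=
      hG.differentiableAt (isOpen_ball.mem_nhds (hsub (hin z hz)))
    exact (hGat.comp z hcay).sub_const c
  have hKH : ∀ z : ℂ, |z.re| ≤ 1 → ‖H z‖ ≤ K := fun z hz => hK _ (hin z hz)
  have hεH : ∀ z : ℂ, z.re = 0 → ‖H z‖ ≤ ε := by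
    intro z hz
    obtain ⟨η, hη, hcz⟩ := cayley_real_of_re_zero hz p hρ.le
    show ‖G _ - c‖ ≤ ε
    rw [hcz]
    exact hflat η hη
  -- the point `p + ib` on the chord as the image of a real point `σ` of the strip
  have hβ : |b / ρ| < 1 := by
    rw [abs_div, abs_of_pos hρ, div_lt_one hρ]; linarith
  obtain ⟨hw1, hwre, hwim, hmob⟩ := unit_of_height hβ
  obtain ⟨hσ1, hσim, hexpσ⟩ := sigma_bound_of_unit hw1 hwre
  set σ : ℝ := 2 / π * arg ((1 + I * (b / ρ : ℝ)) / (1 - I * (b / ρ : ℝ))) with hσdef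
  have hρ0 : (ρ : ℂ) ≠ 0 := Complex.ofReal_ne_zero.mpr hρ.ne'
  have hpoint : (p : ℂ) + ρ * ((exp (I * (π / 2) * (σ : ℂ)) - 1) / (exp (I * (π / 2) * (σ : ℂ)) + 1)) = (p : ℂ) + I * b := by
    rw [hexpσ, hmob]
    push_cast
    congr 1
    calc (ρ : ℂ) * (I * ((b : ℂ) / ρ)) = I * ((ρ : ℂ) * ((b : ℂ) / ρ)) := by ring
      _ = I * b := by rw [mul_div_cancel₀ _ hρ0]
  have hHσ : H σ = G ((p : ℂ) + I * b) - c := by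
    show G _ - c = _
    rw [hpoint]
  have h3 := threeLines_strip hd hKH hεH hσ1.le
  rw [hHσ] at h3
  -- monotonicity of the interpolation bound in the exponent (`K∕ε ≥ 1`)
  have hσt : |σ| ≤ t := by
    refine hσim.trans (hwim.trans ?_)
    rwa [abs_div, abs_of_pos hρ, ← mul_div_assoc]
  refine h3.trans ?_
  have hK0 : 0 < K := hε.trans_le hεK
  have e1 : ε ^ (1 - |σ|) * K ^ |σ| = ε * (K / ε) ^ |σ| := by
    rw [Real.rpow_sub hε, Real.rpow_one, Real.div_rpow hK0.le hε.le]; field_simp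
  have e2 : ε ^ (1 - t) * K ^ t = ε * (K / ε) ^ t := by
    rw [Real.rpow_sub hε, Real.rpow_one, Real.div_rpow hK0.le hε.le]; field_simp
  rw [e1, e2]
  exact mul_le_mul_of_nonneg_left (Real.rpow_le_rpow_of_exponent_le ((one_le_div hε).mpr hεK) hσt) hε.le

/-- **THE BOX BOUND.**  `G` complex-differentiable on `D(0, R_g)`, `L < R_g`, `‖G − c‖ ≤ K` on `D̄(0, L)`, `‖G(η) − c‖ ≤ ε` for real `|η| ≤ L`,
`0 < ε ≤ K`, `s < 1` ⟹ `‖G(ζ) − c‖ ≤ ε^{1−s}K^{s}` on the box `|Re ζ| ≤ L∕2`, `|Im ζ| ≤ Ls∕4` (`threeLines_vertical` on the disc of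
radius `L∕2` about the real point `Re ζ`). [folklore] -/
theorem box_bound {G : ℂ → ℂ} {c : ℂ} {L Rg K ε s : ℝ} (hL : 0 < L) (hLR : L < Rg)
    (hG : DifferentiableOn ℂ G (ball (0 : ℂ) Rg)) (hK : ∀ z ∈ closedBall (0 : ℂ) L, ‖G z - c‖ ≤ K)
    (hflat : ∀ η : ℝ, |η| ≤ L → ‖G η - c‖ ≤ ε) (hε : 0 < ε) (hεK : ε ≤ K) (hs1 : s < 1)
    {ζ : ℂ} (hre : |ζ.re| ≤ L / 2) (him : |ζ.im| ≤ L * s / 4) :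
    ‖G ζ - c‖ ≤ ε ^ (1 - s) * K ^ s := by
  have hζ : ζ = ((ζ.re : ℝ) : ℂ) + I * (ζ.im : ℝ) := by
    apply Complex.ext <;> simp
  rw [hζ]
  have hsub1 : ball ((ζ.re : ℝ) : ℂ) (Rg - L / 2) ⊆ ball (0 : ℂ) Rg := by
    intro z hz
    rw [mem_ball, dist_zero_right] 
    rw [mem_ball, dist_eq_norm] at hz
    have hp : ‖((ζ.re : ℝ) : ℂ)‖ ≤ L / 2 := by rw [Complex.norm_real, Real.norm_eq_abs]; exact hre
    calc ‖z‖ ≤ ‖z - (ζ.re : ℂ)‖ + ‖((ζ.re : ℝ) : ℂ)‖ := norm_le_norm_sub_add _ _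
      _ < (Rg - L / 2) + L / 2 := add_lt_add_of_lt_of_le hz hp
      _ = Rg := by ring
  have hsub2 : closedBall ((ζ.re : ℝ) : ℂ) (L / 2) ⊆ closedBall (0 : ℂ) L := by
    intro z hz
    rw [mem_closedBall, dist_zero_right]
    rw [mem_closedBall, dist_eq_norm] at hz
    have hp : ‖((ζ.re : ℝ) : ℂ)‖ ≤ L / 2 := by rw [Complex.norm_real, Real.norm_eq_abs]; exact hre
    calc ‖z‖ ≤ ‖z - (ζ.re : ℂ)‖ + ‖((ζ.re : ℝ) : ℂ)‖ := norm_le_norm_sub_add _ _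
      _ ≤ L / 2 + L / 2 := add_le_add hz hp
      _ = L := by ring
  refine threeLines_vertical (p := ζ.re) (ρ := L / 2) (R₁ := Rg - L / 2) (by positivity) (by linarith) (hG.mono hsub1)
    (fun z hz => hK z (hsub2 hz)) (fun η hη => hflat η ?_) hε hεK (t := s) ?_ ?_
  · have := abs_le.mp hη; have := abs_le.mp hre
    exact abs_le.mpr ⟨by linarith, by linarith⟩
  · rw [div_le_iff₀ (by positivity)]; nlinarith
  · nlinarith

end Summit.QuantumFields.YangMills.BalabanUVNodes.N22KnitThreeLines

end
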